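import Literature.NumberTheory.Sieve.LinearDispersionEngine
import HarnessLib

/-!
# `PolyMobiusTail`, line `eta-free-multilinear-window`: the dispersion engine of `stub_pair_middle`

Auxiliary stub `stub_pair_middle_dispersion_engine` for the crux
`Summit.Parity.BatemanHorn.Theses.PolynomialMobius.PolyMobiusTail` (statement item
`stmt-Parity-0870`), middle (dispersion) range `x^{σ₁} < min(d₀,d₁) ≤ x^{σ₂}` of the `k = 2`
linear window.  The mathematics is the Literature theorem
`Literature.NumberTheory.Sieve.LD_dispersion_engine` (Linnik's dispersion method: expand the
square, Chinese-remainder phases, Poisson summation in `d` over a progression, Fourier decay of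
the weight, incomplete Kloosterman sums with a linear twist bounded by Weil's bound, gcd sums; the
main term is the `h = 0` term); this file only records it under the registered stub name, with
the registered signature verbatim.  The lead assembles `stub_pair_middle` from it, the box
reduction `stub_pair_middle_box_reduction`, the shell counts and the main-term evaluation.
-/

namespace Summit.Parity.BatemanHorn.Theorems.PolyMobiusTail.EtaFreeWindow

open Finset MeasureTheory

/-- **Auxiliary stub `stub_pair_middle_dispersion_engine`** (the dispersion engine of
`stub_pair_middle`, line `eta-free-multilinear-window` of the crux `PolyMobiusTail`).  Linnik's
dispersion method for the bilinear form in the divisibility conditions `u ∣ A d (c_m + Qy) + B`: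
for nonzero integers `A, B` and `C₀, C₂ ≥ 0` there is `K > 0` such that for every modulus `Q ≥ 1`,
classes `c_d, c_m`, scales `P, R, T ≥ 1`, range `y₁ ≤ y₂`, moduli `u ∈ U` squarefree, coprime
to `|A|·|B|·Q`, `P < u ≤ 2P`, `τ(u) ≤ T`, coefficients `|α_u| ≤ 1` and a smooth weight `F ≥ 0`
supported in `[R/2, 4R]` with `|F| ≤ C₀`, `|F''| ≤ C₂R⁻²`,
`|∑_{d ≤ 4R, d ≡ c_d (Q)} F(d) |∑_u α_u ∑_{y₁<y≤y₂} [u ∣ A d (c_m+Qy) + B]|² − MT|`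
`≤ K T⁴ (1 + log 2PQR)³ ((Q(y₂−y₁+1))² + P³)`, where
`MT = (∫F)/Q · ∑_{u,u'} α_u ᾱ_{u'} #{(y,y') : (m,u) = (m',u') = 1, m ≡ m' ((u,u'))}/[u,u']`.
This is `Literature.NumberTheory.Sieve.LD_dispersion_engine` (stated there with the hypotheses on
`A, B, C₀, C₂` as binders; the proposition is the same). -/
theorem stub_pair_middle_dispersion_engine :
    ∀ (A B : ℤ) (C₀ C₂ : ℝ), A ≠ 0 → B ≠ 0 → 0 ≤ C₀ → 0 ≤ C₂ →
    ∃ K : ℝ, 0 < K ∧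
    ∀ (Q : ℕ) (cd cm : ℤ) (P R T : ℝ) (y₁ y₂ : ℤ) (U : Finset ℕ) (α : ℕ → ℂ) (F : ℝ → ℝ),
      0 < Q → 1 ≤ P → 1 ≤ R → 1 ≤ T → y₁ ≤ y₂ →
      (∀ u ∈ U, Squarefree u ∧ Nat.Coprime u (A.natAbs * B.natAbs * Q) ∧ P < (u : ℝ) ∧ (u : ℝ) ≤ 2 * P ∧
        ((Nat.divisors u).card : ℝ) ≤ T) →
      (∀ u, ‖α u‖ ≤ 1) →
      ContDiff ℝ ((⊤ : ℕ∞) : WithTop ℕ∞) F → (∀ x, F x ≠ 0 → R / 2 ≤ x ∧ x ≤ 4 * R) → (∀ x, 0 ≤ F x) →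
      (∀ x, ‖F x‖ ≤ C₀) → (∀ x, ‖iteratedDeriv 2 F x‖ ≤ C₂ / R ^ 2) →
      ‖(∑ d ∈ (Finset.range (⌊4 * R⌋₊ + 1)).filter (fun d : ℕ => (d : ℤ) ≡ cd [ZMOD Q]),
          ((F d : ℝ) : ℂ) *
            (‖∑ u ∈ U, α u * ∑ y ∈ Finset.Ioc y₁ y₂,
                (if (u : ℤ) ∣ A * d * (cm + Q * y) + B then (1 : ℂ) else 0)‖ : ℂ) ^ 2)
        - ((∫ x, F x : ℝ) : ℂ) / (Q : ℂ) *
          ∑ u ∈ U, ∑ u' ∈ U, α u * (starRingEnd ℂ) (α u') *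
            ((((Finset.Ioc y₁ y₂) ×ˢ (Finset.Ioc y₁ y₂)).filter (fun p : ℤ × ℤ =>
                Int.gcd (cm + Q * p.1) u = 1 ∧ Int.gcd (cm + Q * p.2) u' = 1 ∧
                cm + Q * p.1 ≡ cm + Q * p.2 [ZMOD (Nat.gcd u u' : ℕ)])).card : ℂ) /
            ((Nat.lcm u u' : ℕ) : ℂ)‖ ≤
        K * T ^ 4 * (1 + Real.log (2 * P * Q * R)) ^ 3 *
          (((Q : ℝ) * ((y₂ - y₁ : ℤ) + 1)) ^ 2 + P ^ 3) :=
  Literature.NumberTheory.Sieve.LD_dispersion_engine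

end Summit.Parity.BatemanHorn.Theorems.PolyMobiusTail.EtaFreeWindow
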